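import Summits.Ventures.Crystal3D.Theorems.StickyWulffConstantGenericWallFloorGrainLedgerTop
import Summits.Ventures.Crystal3D.Theorems.StickyWulffConstantNoReconstructionGainLatticeAdhesion
import HarnessLib

/-!
# The rigid-bicrystal rung of `stub_twoSlabAdhesion`, modulo local non-saturation

HONEST FRAMING. Part of the venture `Summits/Ventures/Crystal3D` (cell `crystal3d-full`), helper for the
crux `GenericWallFloor` (stmt-Ventures-19480) of `route-Ventures-StickyWulffConstant`, REGISTERED line
`WallLedgerG` (planner cf-p1 gen 16), stub `stub_twoSlabAdhesion` (THE CRUX of the line).  This file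
is a RUNG, not the stub: it proves the stub's inequality for RIGID fillings under explicit extra
hypotheses.  Rung credit only; F-C1 not moved.

**Theorem (`rigid_ledger_ge`, deficiency form).**  In the cell of `TwoSlabAdhesion` (a `1`-separated
configuration `X` in `{−2R₀ ≤ x₂ ≤ h + 2R₀, x₀² + x₁² ≤ ρ²}`, `3 ≤ R₀ ≤ ρ`, containing the complete
clamped slabs `P₁ ⊆ Λ₁ = A₁·Λ₀ + t₁` in `[−2R₀, −R₀]` and `P₂ ⊆ Λ₂ = A₂·Λ₀ + t₂` in `[h + R₀, h + 2R₀]`),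
assume
* RIGID: every ball of `X` lies on `Λ₁` or on `Λ₂`, and DISJOINT: `Λ₁ ∩ Λ₂ = ∅` (no coincidence sites);
* CLEAN OUTER SLIVERS: balls below height `−2R₀ + 1` are on `Λ₁`, balls above `h + 2R₀ − 1` on `Λ₂`;
* LOCAL NON-SATURATION (both grains, every slot `u`): a grain ball `x` with `x + A u ∉ X`,
  `x − A u ∈ X` and a foreign contact has at most eleven contacts.
Then `D(X) ≥ (φ₁ + φ₂ + 1) π ρ² − (130 √2 π + 624 (4R₀ + 2)) (1 + h) ρ` with the crux's inlined
`φᵢ = (√2/4) ∑ᶠ_{w ∈ Λ₀, ‖w‖ = 1} |⟪w, Aᵢ⁻¹ e₃⟫|`.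

**Corollary (`rigid_twoSlabAdhesion`, the stub's shape).**  Under the same three hypotheses the
conclusion of `TwoSlabAdhesion` holds with `R₀ = 3`:
`cross(P₁, X \ P₁) + cross(P₂, Y) ≤ D(Y) + (φ₁ + φ₂ − 1) π ρ² + C (1 + h) ρ`
(`…LatticeAdhesion.contactDeficiency_sdiff_split` twice and the upper slab count
`affineSampleDeficit_upper`).

Proof = the slot ledger `2 D(X) = Σ_x (12 − deg x)` split over the two grains, each grain paying its
two faces plus one (`grain_ledger_ge`, `grain_ledger_ge_top`, with the steep slots of
`exists_steep_slot`).  WHY THE HYPOTHESES (census on the item): non-saturation is the one local input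
(M5/M7 certified computations; FALSE for twins, where it must fail); disjointness avoids double crediting
at coincidence sites (CSL pairs); the clean slivers exclude foreign balls hiding below the lowest (above
the highest) grain layer, which the cell's hypotheses do not forbid and which would have to be paid by
their own deficiency.
-/

noncomputable section

namespace Summit.Ventures.Crystal3D.Theorems

open Summit.Ventures.Crystal3D Finset
open Literature.MathematicalPhysics.StatisticalMechanics (fccStacking orderedContacts contactDeficiency)
open scoped InnerProductSpace

/-- `Σ_{x ∈ X} #{q ∈ X : dist x q = 1} = orderedContacts X`. -/
theorem sum_card_contacts_eq_orderedContacts (X : Finset (EuclideanSpace ℝ (Fin 3))) :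
    ∑ x ∈ X, (X.filter fun q => dist x q = 1).card = orderedContacts X := by
  classical
  rw [orderedContacts, Finset.card_filter, Finset.sum_product]
  refine Finset.sum_congr rfl fun x _ => ?_
  rw [Finset.card_filter]

/-- **The slot ledger identity** `2 D(X) = Σ_{x ∈ X} (12 − deg x)`. -/
theorem two_mul_contactDeficiency_eq_sum (X : Finset (EuclideanSpace ℝ (Fin 3))) :
    2 * contactDeficiency X = ∑ x ∈ X, ((12 : ℝ) - ((X.filter fun q => dist x q = 1).card : ℝ)) := by
  classical
  rw [contactDeficiency, Finset.sum_sub_distrib, Finset.sum_const, nsmul_eq_mul, ← Nat.cast_sum,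
    sum_card_contacts_eq_orderedContacts]
  ring

/-- The crux's inlined `φ(A⁻¹ e₃)` is the plain slot sum `Σ_{w ∈ fccSlots} |⟪A w, e₃⟫|` (times `√2/4`). -/
theorem finsum_unit_fcc_symm_eq_sum_slots (A : EuclideanSpace ℝ (Fin 3) ≃ₗᵢ[ℝ] EuclideanSpace ℝ (Fin 3)) :
    ∑ᶠ w ∈ {w ∈ fccStacking 1 (Real.sqrt (2 / 3)) | ‖w‖ = 1},
        |⟪w, A.symm (EuclideanSpace.single (2 : Fin 3) (1 : ℝ))⟫_ℝ| =
      ∑ w ∈ fccSlots, |⟪A w, EuclideanSpace.single (2 : Fin 3) (1 : ℝ)⟫_ℝ| := by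
  rw [finsum_unit_fcc_eq_sum]
  refine Finset.sum_congr rfl fun w _ => ?_
  rw [← LinearIsometryEquiv.inner_map_map A w, LinearIsometryEquiv.apply_symm_apply]

open scoped Classical in
/-- **The rigid-bicrystal rung, deficiency form.**  See the module docstring. -/
theorem rigid_ledger_ge
    (A₁ : EuclideanSpace ℝ (Fin 3) ≃ₗᵢ[ℝ] EuclideanSpace ℝ (Fin 3)) (t₁ : EuclideanSpace ℝ (Fin 3))
    (A₂ : EuclideanSpace ℝ (Fin 3) ≃ₗᵢ[ℝ] EuclideanSpace ℝ (Fin 3)) (t₂ : EuclideanSpace ℝ (Fin 3))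
    (X P₁ P₂ : Finset (EuclideanSpace ℝ (Fin 3))) (R₀ h ρ : ℝ) (hR₀ : 3 ≤ R₀) (hh : 0 ≤ h) (hρ : R₀ ≤ ρ)
    (hX : ∀ p ∈ X, ∀ q ∈ X, p ≠ q → 1 ≤ dist p q) (hP₁X : P₁ ⊆ X) (hP₂X : P₂ ⊆ X)
    (hcell : ∀ p ∈ X, -(2 * R₀) ≤ p 2 ∧ p 2 ≤ h + 2 * R₀ ∧ p 0 ^ 2 + p 1 ^ 2 ≤ ρ ^ 2)
    (hP₁ : ∀ p, p ∈ P₁ ↔ (p ∈ (fun q => A₁ q + t₁) '' fccStacking 1 (Real.sqrt (2 / 3)) ∧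
      -(2 * R₀) ≤ p 2 ∧ p 2 ≤ -R₀ ∧ p 0 ^ 2 + p 1 ^ 2 ≤ ρ ^ 2))
    (hP₂ : ∀ p, p ∈ P₂ ↔ (p ∈ (fun q => A₂ q + t₂) '' fccStacking 1 (Real.sqrt (2 / 3)) ∧
      h + R₀ ≤ p 2 ∧ p 2 ≤ h + 2 * R₀ ∧ p 0 ^ 2 + p 1 ^ 2 ≤ ρ ^ 2))
    (hrigid : ∀ x ∈ X, x ∈ (fun q => A₁ q + t₁) '' fccStacking 1 (Real.sqrt (2 / 3)) ∨
      x ∈ (fun q => A₂ q + t₂) '' fccStacking 1 (Real.sqrt (2 / 3)))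
    (hdisj : ∀ p ∈ (fun q => A₁ q + t₁) '' fccStacking 1 (Real.sqrt (2 / 3)),
      p ∉ (fun q => A₂ q + t₂) '' fccStacking 1 (Real.sqrt (2 / 3)))
    (hclean₁ : ∀ p ∈ X, p 2 < -(2 * R₀) + 1 → p ∈ (fun q => A₁ q + t₁) '' fccStacking 1 (Real.sqrt (2 / 3)))
    (hclean₂ : ∀ p ∈ X, h + 2 * R₀ - 1 < p 2 → p ∈ (fun q => A₂ q + t₂) '' fccStacking 1 (Real.sqrt (2 / 3)))
    (hunsat₁ : ∀ u ∈ fccSlots, ∀ x ∈ X, x ∈ (fun q => A₁ q + t₁) '' fccStacking 1 (Real.sqrt (2 / 3)) →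
      x + A₁ u ∉ X → x - A₁ u ∈ X →
      (∃ q ∈ X, q ∉ (fun q => A₁ q + t₁) '' fccStacking 1 (Real.sqrt (2 / 3)) ∧ dist x q = 1) →
      (X.filter fun q => dist x q = 1).card ≤ 11)
    (hunsat₂ : ∀ u ∈ fccSlots, ∀ x ∈ X, x ∈ (fun q => A₂ q + t₂) '' fccStacking 1 (Real.sqrt (2 / 3)) →
      x + A₂ u ∉ X → x - A₂ u ∈ X →
      (∃ q ∈ X, q ∉ (fun q => A₂ q + t₂) '' fccStacking 1 (Real.sqrt (2 / 3)) ∧ dist x q = 1) →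
      (X.filter fun q => dist x q = 1).card ≤ 11) :
    (Real.sqrt 2 / 4 * ∑ᶠ w ∈ {w ∈ fccStacking 1 (Real.sqrt (2 / 3)) | ‖w‖ = 1},
          |⟪w, A₁.symm (EuclideanSpace.single (2 : Fin 3) (1 : ℝ))⟫_ℝ| +
        Real.sqrt 2 / 4 * ∑ᶠ w ∈ {w ∈ fccStacking 1 (Real.sqrt (2 / 3)) | ‖w‖ = 1},
          |⟪w, A₂.symm (EuclideanSpace.single (2 : Fin 3) (1 : ℝ))⟫_ℝ| + 1) * Real.pi * ρ ^ 2 -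
        (130 * Real.sqrt 2 * Real.pi + 624 * (4 * R₀ + 2)) * (1 + h) * ρ ≤
      contactDeficiency X := by
  classical
  set e₃ : EuclideanSpace ℝ (Fin 3) := EuclideanSpace.single (2 : Fin 3) (1 : ℝ) with he₃
  set Λ₁ : Set (EuclideanSpace ℝ (Fin 3)) := (fun q => A₁ q + t₁) '' fccStacking 1 (Real.sqrt (2 / 3)) with hΛ₁
  set Λ₂ : Set (EuclideanSpace ℝ (Fin 3)) := (fun q => A₂ q + t₂) '' fccStacking 1 (Real.sqrt (2 / 3)) with hΛ₂
  have he₃n : ‖e₃‖ = 1 := by rw [he₃, PiLp.norm_single, norm_one]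
  -- steep slots
  obtain ⟨u₁, hu₁Λ, hu₁n, hu₁⟩ := exists_steep_slot (A₁.symm e₃) (by rw [LinearIsometryEquiv.norm_map, he₃n])
  obtain ⟨u₂, hu₂Λ, hu₂n, hu₂⟩ := exists_steep_slot (-A₂.symm e₃)
    (by rw [norm_neg, LinearIsometryEquiv.norm_map, he₃n])
  have hu₁s : u₁ ∈ fccSlots := mem_fccSlots_of_unit hu₁Λ hu₁n
  have hu₂s : u₂ ∈ fccSlots := mem_fccSlots_of_unit hu₂Λ hu₂n
  have hsteep₁ : Real.sqrt 2 / 2 ≤ ⟪A₁ u₁, e₃⟫_ℝ := by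
    rwa [← LinearIsometryEquiv.inner_map_map A₁ u₁, LinearIsometryEquiv.apply_symm_apply] at hu₁
  have hsteep₂ : ⟪A₂ u₂, e₃⟫_ℝ ≤ -(Real.sqrt 2 / 2) := by
    rw [inner_neg_right, ← LinearIsometryEquiv.inner_map_map A₂ u₂, LinearIsometryEquiv.apply_symm_apply] at hu₂
    linarith
  -- the two grain lemmas
  have G₁ := grain_ledger_ge A₁ t₁ X P₁ R₀ h ρ hR₀ hh hρ hX hcell hP₁X hP₁ hclean₁ hu₁s hsteep₁
    (hunsat₁ u₁ hu₁s)
  have G₂ := grain_ledger_ge_top A₂ t₂ X P₂ R₀ h ρ hR₀ hh hρ hX hcell hP₂X hP₂ hclean₂ hu₂s hsteep₂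
    (hunsat₂ u₂ hu₂s)
  -- the ledger splits over the two (disjoint, exhausting) grains
  have hsplit : ∑ x ∈ X, ((12 : ℝ) - ((X.filter fun q => dist x q = 1).card : ℝ)) =
      ∑ x ∈ X.filter (fun x => x ∈ Λ₁), ((12 : ℝ) - ((X.filter fun q => dist x q = 1).card : ℝ)) +
      ∑ x ∈ X.filter (fun x => x ∈ Λ₂), ((12 : ℝ) - ((X.filter fun q => dist x q = 1).card : ℝ)) := by
    rw [← Finset.sum_union]
    · congr 1
      ext x
      simp only [mem_union, mem_filter]
      constructor
      · intro hx; exact (hrigid x hx).elim (fun h1 => Or.inl ⟨hx, h1⟩) (fun h2 => Or.inr ⟨hx, h2⟩)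
      · rintro (⟨hx, -⟩ | ⟨hx, -⟩) <;> exact hx
    · rw [Finset.disjoint_filter]
      intro x _ h1 h2
      exact hdisj x h1 h2
  have hled := two_mul_contactDeficiency_eq_sum X
  rw [hsplit] at hled
  rw [finsum_unit_fcc_symm_eq_sum_slots A₁, finsum_unit_fcc_symm_eq_sum_slots A₂]
  linarith

open scoped Classical in
/-- **The rigid-bicrystal rung of `stub_twoSlabAdhesion`** in the stub's own shape (`R₀ = 3`): for every
pair of moved fcc lattices with `Λ₁ ∩ Λ₂ = ∅` there is `C` such that the conclusion of `TwoSlabAdhesion`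
holds for every cell whose filling is RIGID (`X ⊆ Λ₁ ∪ Λ₂`), has clean outer slivers, and satisfies
the local non-saturation property on both grains.  See the module docstring. -/
theorem rigid_twoSlabAdhesion
    (A₁ : EuclideanSpace ℝ (Fin 3) ≃ₗᵢ[ℝ] EuclideanSpace ℝ (Fin 3)) (t₁ : EuclideanSpace ℝ (Fin 3))
    (A₂ : EuclideanSpace ℝ (Fin 3) ≃ₗᵢ[ℝ] EuclideanSpace ℝ (Fin 3)) (t₂ : EuclideanSpace ℝ (Fin 3))
    (hdisj : ∀ p ∈ (fun q => A₁ q + t₁) '' fccStacking 1 (Real.sqrt (2 / 3)),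
      p ∉ (fun q => A₂ q + t₂) '' fccStacking 1 (Real.sqrt (2 / 3))) :
    ∃ C R₀ : ℝ, 1 ≤ R₀ ∧ ∀ h : ℝ, 0 ≤ h → ∀ ρ : ℝ, R₀ ≤ ρ →
      ∀ X P₁ P₂ : Finset (EuclideanSpace ℝ (Fin 3)),
      (∀ p ∈ X, ∀ q ∈ X, p ≠ q → 1 ≤ dist p q) → P₁ ⊆ X → P₂ ⊆ X \ P₁ →
      (∀ p ∈ X, -(2 * R₀) ≤ p 2 ∧ p 2 ≤ h + 2 * R₀ ∧ p 0 ^ 2 + p 1 ^ 2 ≤ ρ ^ 2) →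
      (∀ p, p ∈ P₁ ↔ (p ∈ (fun q => A₁ q + t₁) '' fccStacking 1 (Real.sqrt (2 / 3)) ∧
        -(2 * R₀) ≤ p 2 ∧ p 2 ≤ -R₀ ∧ p 0 ^ 2 + p 1 ^ 2 ≤ ρ ^ 2)) →
      (∀ p, p ∈ P₂ ↔ (p ∈ (fun q => A₂ q + t₂) '' fccStacking 1 (Real.sqrt (2 / 3)) ∧
        h + R₀ ≤ p 2 ∧ p 2 ≤ h + 2 * R₀ ∧ p 0 ^ 2 + p 1 ^ 2 ≤ ρ ^ 2)) →
      -- RIGID filling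
      (∀ x ∈ X, x ∈ (fun q => A₁ q + t₁) '' fccStacking 1 (Real.sqrt (2 / 3)) ∨
        x ∈ (fun q => A₂ q + t₂) '' fccStacking 1 (Real.sqrt (2 / 3))) →
      -- CLEAN outer slivers
      (∀ p ∈ X, p 2 < -(2 * R₀) + 1 → p ∈ (fun q => A₁ q + t₁) '' fccStacking 1 (Real.sqrt (2 / 3))) →
      (∀ p ∈ X, h + 2 * R₀ - 1 < p 2 → p ∈ (fun q => A₂ q + t₂) '' fccStacking 1 (Real.sqrt (2 / 3))) →
      -- local NON-SATURATION of top-structured grain balls with a foreign contact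
      (∀ u ∈ fccSlots, ∀ x ∈ X, x ∈ (fun q => A₁ q + t₁) '' fccStacking 1 (Real.sqrt (2 / 3)) →
        x + A₁ u ∉ X → x - A₁ u ∈ X →
        (∃ q ∈ X, q ∉ (fun q => A₁ q + t₁) '' fccStacking 1 (Real.sqrt (2 / 3)) ∧ dist x q = 1) →
        (X.filter fun q => dist x q = 1).card ≤ 11) →
      (∀ u ∈ fccSlots, ∀ x ∈ X, x ∈ (fun q => A₂ q + t₂) '' fccStacking 1 (Real.sqrt (2 / 3)) →
        x + A₂ u ∉ X → x - A₂ u ∈ X →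
        (∃ q ∈ X, q ∉ (fun q => A₂ q + t₂) '' fccStacking 1 (Real.sqrt (2 / 3)) ∧ dist x q = 1) →
        (X.filter fun q => dist x q = 1).card ≤ 11) →
      ((((P₁ ×ˢ (X \ P₁)).filter fun pq => dist pq.1 pq.2 = 1).card : ℕ) : ℝ) +
        ((((P₂ ×ˢ ((X \ P₁) \ P₂)).filter fun pq => dist pq.1 pq.2 = 1).card : ℕ) : ℝ) ≤
        contactDeficiency ((X \ P₁) \ P₂) +
          (Real.sqrt 2 / 4 * ∑ᶠ w ∈ {w ∈ fccStacking 1 (Real.sqrt (2 / 3)) | ‖w‖ = 1},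
              |⟪w, A₁.symm (EuclideanSpace.single (2 : Fin 3) (1 : ℝ))⟫_ℝ| +
            Real.sqrt 2 / 4 * ∑ᶠ w ∈ {w ∈ fccStacking 1 (Real.sqrt (2 / 3)) | ‖w‖ = 1},
              |⟪w, A₂.symm (EuclideanSpace.single (2 : Fin 3) (1 : ℝ))⟫_ℝ| - 1) * Real.pi * ρ ^ 2 +
          C * (1 + h) * ρ := by
  classical
  obtain ⟨C₁, hC₁⟩ := affineSampleDeficit_upper A₁ t₁ 3 (by norm_num)
  obtain ⟨C₂, hC₂⟩ := affineSampleDeficit_upper A₂ t₂ 3 (by norm_num)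
  refine ⟨(130 * Real.sqrt 2 * Real.pi + 624 * (4 * 3 + 2)) + |C₁| + |C₂|, 3, by norm_num, ?_⟩
  intro h hh ρ hρ X P₁ P₂ hX hP₁X hP₂X hcell hP₁ hP₂ hrigid hclean₁ hclean₂ hunsat₁ hunsat₂
  set φ₁ : ℝ := Real.sqrt 2 / 4 * ∑ᶠ w ∈ {w ∈ fccStacking 1 (Real.sqrt (2 / 3)) | ‖w‖ = 1},
      |⟪w, A₁.symm (EuclideanSpace.single (2 : Fin 3) (1 : ℝ))⟫_ℝ| with hφ₁
  set φ₂ : ℝ := Real.sqrt 2 / 4 * ∑ᶠ w ∈ {w ∈ fccStacking 1 (Real.sqrt (2 / 3)) | ‖w‖ = 1},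
      |⟪w, A₂.symm (EuclideanSpace.single (2 : Fin 3) (1 : ℝ))⟫_ℝ| with hφ₂
  have hP₂X' : P₂ ⊆ X := hP₂X.trans Finset.sdiff_subset
  -- the ledger bound
  have hled := rigid_ledger_ge A₁ t₁ A₂ t₂ X P₁ P₂ 3 h ρ le_rfl hh hρ hX hP₁X hP₂X' hcell hP₁ hP₂ hrigid
    hdisj hclean₁ hclean₂ hunsat₁ hunsat₂
  -- the two upper slab counts
  have hD₁ := hC₁ (-(2 * 3)) (-3) (by ring) ρ hρ P₁ hP₁
  have hD₂ := hC₂ (h + 3) (h + 2 * 3) (by ring) ρ hρ P₂ hP₂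
  -- the two splits
  have hsplit₁ := contactDeficiency_sdiff_split hP₁X
  have hsplit₂ := contactDeficiency_sdiff_split hP₂X
  -- constants
  have hρ0 : (0 : ℝ) ≤ ρ := by linarith
  have hb : C₁ * ρ ≤ |C₁| * (1 + h) * ρ := by
    have h1 : 0 ≤ (|C₁| - C₁) * ρ := mul_nonneg (by linarith [le_abs_self C₁]) hρ0
    have h2 : 0 ≤ |C₁| * h * ρ := by positivity
    nlinarith
  have hc : C₂ * ρ ≤ |C₂| * (1 + h) * ρ := by
    have h1 : 0 ≤ (|C₂| - C₂) * ρ := mul_nonneg (by linarith [le_abs_self C₂]) hρ0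
    have h2 : 0 ≤ |C₂| * h * ρ := by positivity
    nlinarith
  rw [← hφ₁, ← hφ₂] at hled
  linarith

end Summit.Ventures.Crystal3D.Theorems

end
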